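import Summits.BirchSwinnertonDyer.BirchSwinnertonDyer.Theorems.ByReductionTypeAtTwoAdditivePotGoodPrintZhaiIrreducibleInstancesA
import Summits.BirchSwinnertonDyer.BirchSwinnertonDyer.Theorems.ByReductionTypeAtTwoAdditivePotGoodPrintZhaiIrreducibleInstancesB
import Summits.BirchSwinnertonDyer.BirchSwinnertonDyer.Theorems.ByReductionTypeAtTwoAdditivePotGoodPrintZhaiIrreducibleInstancesC
import HarnessLib

/-!
# K4 crux `AdditiveRankZeroAtTwo` (19098), child C3″ `AdditivePotGoodLowerHalfAtTwo` (22617): the ZHAI 2016 print road is NOT VACUOUS at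
# the bases `124B1`, `200E1`, `116B1`, `540A1`, `196B1` — one kernel-certified twisting prime each (`104A1^{(−3)}` is in file A)

Cell `bsd-2adic`, seat `bsd-2adic-k4-w2` GEN 6 (prover, explicit unit, no kit); `--supports stmt-BirchSwinnertonDyer-22617 --as helper`;
companion of `…PrintZhaiIrreducibleInstances{A,B,C}.lean`. HONEST FRAMING (D-0036/D-0054): for each base `V` the KERNEL certifies one member
`M = q*` of Zhai's family — `a_q(V)` odd (certified point count `#Ẽ(𝔽_q)` ⇒ `q` inert in the cubic `2`-division field, U2's dictionary
`isInertIn_of_odd_frobeniusTrace`), `M ≡ 1 (mod 4)` square-free, `(q, N) = 1` from `N ∣ |Δ_min|` — and the base file's road gives, at every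
global minimal `W ≅ V^{(M)}`: `r_an(W) = 0`, `Addv W 2`, `0 ≤ ord₂ j`, `¬CM`, `Irr W 2` and the LOWER half `MissingLowerBoundAt W 2`.
Displayed, exactly as printed: the optimality datum (`Dt`, `hopt`) and the record `ord₂(L(V,1)/Ω_∞(V))`; by name: Zhai 2016 Thm. 1.1/1.2
(corrected, arXiv v2), Agashe–Ribet–Stein Thm. 2.6, modularity. Closes nothing at the `∀`-level; nothing booked; BSD is not proved by any of this.
References: [Zhai2016] Thms. 1.1–1.2; [SilvermanAEC2009] V.2, III.2.3; [Miller2011LMS] Def. 1.1.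
-/

set_option autoImplicit false
-- the Theorems namespace of this sub repeats the summit name by design (D-0017 nested layout)
set_option linter.dupNamespace false

noncomputable section

open scoped Classical

open WeierstrassCurve Literature.NumberTheory.EllipticCurves
  Literature.NumberTheory.EllipticCurves.ModularForms
  Literature.NumberTheory.EllipticCurves.Rank1Residual
  Literature.NumberTheory.EllipticCurves.Rank1Residual.Typed
  Literature.NumberTheory.EllipticCurves.CoatesLiTianZhai2015
  Literature.NumberTheory.EllipticCurves.Zhai2016
  Literature.NumberTheory.EllipticCurves.AgasheRibetStein2006
  Summit.BirchSwinnertonDyer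
  Summit.BirchSwinnertonDyer.Rank1Residual
  Summit.BirchSwinnertonDyer.Rank1Residual.X11b
  Summit.BirchSwinnertonDyer.Rank1Residual.X5.O1
  Summit.BirchSwinnertonDyer.Rank1Residual.P2
  Summit.BirchSwinnertonDyer.BirchSwinnertonDyer.Rank1Residual.IntModel
  Summit.BirchSwinnertonDyer.BirchSwinnertonDyer.Theorems

namespace Summit.BirchSwinnertonDyer.BirchSwinnertonDyer.Theorems.AddPotGoodPrint

/-! ## Witness member `124B1^{(5)}`: `a_5(124B1) = 1` odd ⇒ `5` inert in the cubic `2`-division field; `M = 5* = 5 ≡ 1 (mod 4)` -/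
section Witness124B1

/-- **`#Ẽ(𝔽_5) = 5` for `124B1`** (certified count `countPoints`, `decide +kernel`; `5 ∤ Δ = -496`). [cite: SilvermanAEC2009, V.2] -/
theorem reductionPointCount_5_124B1 [(⟨0, 0, 0, -17, -27⟩ : WeierstrassCurve ℚ).IsGloballyMinimal] :
    (⟨0, 0, 0, -17, -27⟩ : WeierstrassCurve ℚ).reductionPointCount 5 = 5 := by
  haveI : Fact (Nat.Prime 5) := ⟨by norm_num⟩
  haveI := isElliptic_124B1
  exact Supersingular.reductionPointCount_eq_of_intModel_countPoints intModel_124B1 5 (by norm_num) (by decide +kernel)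
    (by decide +kernel)

/-- **`a_5(124B1) = 1` is odd**: `Frob_5` is a `3`-cycle on `E[2] ∖ {0}`, i.e. `5` is inert in the cubic `2`-division field of
`124B1` (Zhai's twisting condition). [cite: Zhai2016, Thm. 1.1 (hypothesis "inert in F")] -/
theorem odd_frobeniusTrace_5_124B1 [(⟨0, 0, 0, -17, -27⟩ : WeierstrassCurve ℚ).IsGloballyMinimal] :
    Odd ((⟨0, 0, 0, -17, -27⟩ : WeierstrassCurve ℚ).frobeniusTrace 5) := by
  rw [Uniform.U2.odd_frobeniusTrace_iff_odd_reductionPointCount _ (by norm_num : Nat.Prime 5) (by norm_num),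
    reductionPointCount_5_124B1]
  decide

/-- **C3″'s conclusion at every global minimal model of `124B1^{(5)}`** — the member `M = 5* = 5` of the Zhai-1.1 family of
`124B1` (`5 ≡ 1 (mod 4)` square-free, `(5, N) = 1` since `N ∣ |Δ| = 496`, `5` inert in the cubic `2`-division field because
`a_5 = 1` is odd — ALL IN THE KERNEL; `F` exists by `U2.exists_isTwoDivisionField`). Displayed: the optimality datum and the record
`ord₂(L(124B1,1)/Ω_∞) = 0`; by name: Zhai Thm. 1.1 (corrected), ARS Thm. 2.6, modularity. The `124B1` road is not vacuous.
BSD is not proved by any of this. [cite: Zhai2016, Thm. 1.1] [cite: AgasheRibetStein2006, Thm. 2.6] [cite: Miller2011LMS, Def. 1.1] -/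
theorem printFamily124B1_witness_5 (h11 : thm11_ordTwo_LAlg_twist_eq_zero')
    (h26 : cremona_abs_maninConstant_eq_one_of_level_le) (hmod : hasEntireLFunction_rat)
    [hN : haveI := isElliptic_124B1; NeZero ((⟨0, 0, 0, -17, -27⟩ : WeierstrassCurve ℚ).conductorNorm ℤ)]
    (Dt : haveI := isElliptic_124B1; ModularParametrizationData (⟨0, 0, 0, -17, -27⟩ : WeierstrassCurve ℚ) ((⟨0, 0, 0, -17, -27⟩ : WeierstrassCurve ℚ).conductorNorm ℤ))
    (hopt : haveI := isElliptic_124B1; Zhai2021.IsOptimalDatum (⟨0, 0, 0, -17, -27⟩ : WeierstrassCurve ℚ) Dt)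
    (hL : haveI := isElliptic_124B1; ∃ x : ℚ, IsLAlg (⟨0, 0, 0, -17, -27⟩ : WeierstrassCurve ℚ) x ∧ x ≠ 0 ∧ padicValRat 2 x = 0)
    (W : WeierstrassCurve ℚ) [W.IsElliptic] [W.IsGloballyMinimal]
    (hW : ∃ C : VariableChange ℚ, C • (⟨0, 0, 0, -17, -27⟩ : WeierstrassCurve ℚ).quadraticTwist ((5 : ℤ) : ℚ) = W) :
    haveI : Fact (Nat.Prime 2) := ⟨Nat.prime_two⟩
    W.analyticRank = 0 ∧ Addv W 2 ∧ 0 ≤ padicValRat 2 W.j ∧ ¬ W.HasCM ∧ Irr W 2 ∧ MissingLowerBoundAt W 2 := by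
  haveI : Fact (Nat.Prime 2) := ⟨Nat.prime_two⟩
  haveI := isElliptic_124B1; haveI := isGloballyMinimal_124B1
  have hq : Nat.Prime 5 := by norm_num
  obtain ⟨F, _, _, hF⟩ := Uniform.U2.exists_isTwoDivisionField (⟨0, 0, 0, -17, -27⟩ : WeierstrassCurve ℚ)
    ((X5.O1.irr_two_iff_forall_two_nsmul _).mp irr_two_124B1)
  have hgood : ¬ ((5 : ℕ) : ℤ) ∣ minimalDiscriminantInt (⟨0, 0, 0, -17, -27⟩ : WeierstrassCurve ℚ) := by
    rw [minimalDiscriminantInt_eq intModel_124B1, M124B1_Δ]; decide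
  have hin : IsInertIn F 5 :=
    Uniform.U2.isInertIn_of_odd_frobeniusTrace _ hF hq (by norm_num) hgood odd_frobeniusTrace_5_124B1
  have hna : (5 : ℤ).natAbs = 5 := rfl
  have hgcd : Int.gcd (5 : ℤ) ((⟨0, 0, 0, -17, -27⟩ : WeierstrassCurve ℚ).conductorNorm ℤ) = 1 := by
    have h' : Nat.Coprime 5 ((⟨0, 0, 0, -17, -27⟩ : WeierstrassCurve ℚ).conductorNorm ℤ) :=
      Nat.Coprime.coprime_dvd_right conductorNorm_dvd_124B1 (by norm_num)
    rw [Int.gcd, hna, Int.natAbs_natCast]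
    exact h'
  refine printFamily124B1_lower h11 h26 hmod Dt hopt hL F hF (5 : ℤ) ?_ (by decide) hgcd ?_ ?_ W hW
  · rw [← Int.squarefree_natAbs, hna]; exact hq.prime.squarefree
  · exact ⟨5, by rw [hna, Nat.Prime.primeFactors hq]; simp⟩
  · intro p hp
    rw [hna, Nat.Prime.primeFactors hq, Finset.mem_singleton] at hp
    subst hp
    exact ⟨by norm_num, hin⟩

end Witness124B1

/-! ## Witness member `200E1^{(-3)}`: `a_3(200E1) = 3` odd ⇒ `3` inert in the cubic `2`-division field; `M = 3* = -3 ≡ 1 (mod 4)` -/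
section Witness200E1

/-- **`#Ẽ(𝔽_3) = 1` for `200E1`** (certified count `countPoints`, `decide +kernel`; `3 ∤ Δ = -51200`). [cite: SilvermanAEC2009, V.2] -/
theorem reductionPointCount_3_200E1 [(⟨0, 0, 0, 5, -10⟩ : WeierstrassCurve ℚ).IsGloballyMinimal] :
    (⟨0, 0, 0, 5, -10⟩ : WeierstrassCurve ℚ).reductionPointCount 3 = 1 := by
  haveI : Fact (Nat.Prime 3) := ⟨by norm_num⟩
  haveI := isElliptic_200E1
  exact Supersingular.reductionPointCount_eq_of_intModel_countPoints intModel_200E1 3 (by norm_num) (by decide +kernel)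
    (by decide +kernel)

/-- **`a_3(200E1) = 3` is odd**: `Frob_3` is a `3`-cycle on `E[2] ∖ {0}`, i.e. `3` is inert in the cubic `2`-division field of
`200E1` (Zhai's twisting condition). [cite: Zhai2016, Thm. 1.1 (hypothesis "inert in F")] -/
theorem odd_frobeniusTrace_3_200E1 [(⟨0, 0, 0, 5, -10⟩ : WeierstrassCurve ℚ).IsGloballyMinimal] :
    Odd ((⟨0, 0, 0, 5, -10⟩ : WeierstrassCurve ℚ).frobeniusTrace 3) := by
  rw [Uniform.U2.odd_frobeniusTrace_iff_odd_reductionPointCount _ (by norm_num : Nat.Prime 3) (by norm_num),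
    reductionPointCount_3_200E1]
  decide

/-- **C3″'s conclusion at every global minimal model of `200E1^{(-3)}`** — the member `M = 3* = -3` of the Zhai-1.1 family of
`200E1` (`-3 ≡ 1 (mod 4)` square-free, `(3, N) = 1` since `N ∣ |Δ| = 51200`, `3` inert in the cubic `2`-division field because
`a_3 = 3` is odd — ALL IN THE KERNEL; `F` exists by `U2.exists_isTwoDivisionField`). Displayed: the optimality datum and the record
`ord₂(L(200E1,1)/Ω_∞) = 0`; by name: Zhai Thm. 1.1 (corrected), ARS Thm. 2.6, modularity. The `200E1` road is not vacuous.
BSD is not proved by any of this. [cite: Zhai2016, Thm. 1.1] [cite: AgasheRibetStein2006, Thm. 2.6] [cite: Miller2011LMS, Def. 1.1] -/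
theorem printFamily200E1_witness_neg3 (h11 : thm11_ordTwo_LAlg_twist_eq_zero')
    (h26 : cremona_abs_maninConstant_eq_one_of_level_le) (hmod : hasEntireLFunction_rat)
    [hN : haveI := isElliptic_200E1; NeZero ((⟨0, 0, 0, 5, -10⟩ : WeierstrassCurve ℚ).conductorNorm ℤ)]
    (Dt : haveI := isElliptic_200E1; ModularParametrizationData (⟨0, 0, 0, 5, -10⟩ : WeierstrassCurve ℚ) ((⟨0, 0, 0, 5, -10⟩ : WeierstrassCurve ℚ).conductorNorm ℤ))
    (hopt : haveI := isElliptic_200E1; Zhai2021.IsOptimalDatum (⟨0, 0, 0, 5, -10⟩ : WeierstrassCurve ℚ) Dt)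
    (hL : haveI := isElliptic_200E1; ∃ x : ℚ, IsLAlg (⟨0, 0, 0, 5, -10⟩ : WeierstrassCurve ℚ) x ∧ x ≠ 0 ∧ padicValRat 2 x = 0)
    (W : WeierstrassCurve ℚ) [W.IsElliptic] [W.IsGloballyMinimal]
    (hW : ∃ C : VariableChange ℚ, C • (⟨0, 0, 0, 5, -10⟩ : WeierstrassCurve ℚ).quadraticTwist ((-3 : ℤ) : ℚ) = W) :
    haveI : Fact (Nat.Prime 2) := ⟨Nat.prime_two⟩
    W.analyticRank = 0 ∧ Addv W 2 ∧ 0 ≤ padicValRat 2 W.j ∧ ¬ W.HasCM ∧ Irr W 2 ∧ MissingLowerBoundAt W 2 := by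
  haveI : Fact (Nat.Prime 2) := ⟨Nat.prime_two⟩
  haveI := isElliptic_200E1; haveI := isGloballyMinimal_200E1
  have hq : Nat.Prime 3 := by norm_num
  obtain ⟨F, _, _, hF⟩ := Uniform.U2.exists_isTwoDivisionField (⟨0, 0, 0, 5, -10⟩ : WeierstrassCurve ℚ)
    ((X5.O1.irr_two_iff_forall_two_nsmul _).mp irr_two_200E1)
  have hgood : ¬ ((3 : ℕ) : ℤ) ∣ minimalDiscriminantInt (⟨0, 0, 0, 5, -10⟩ : WeierstrassCurve ℚ) := by
    rw [minimalDiscriminantInt_eq intModel_200E1, M200E1_Δ]; decide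
  have hin : IsInertIn F 3 :=
    Uniform.U2.isInertIn_of_odd_frobeniusTrace _ hF hq (by norm_num) hgood odd_frobeniusTrace_3_200E1
  have hna : (-3 : ℤ).natAbs = 3 := rfl
  have hgcd : Int.gcd (-3 : ℤ) ((⟨0, 0, 0, 5, -10⟩ : WeierstrassCurve ℚ).conductorNorm ℤ) = 1 := by
    have h' : Nat.Coprime 3 ((⟨0, 0, 0, 5, -10⟩ : WeierstrassCurve ℚ).conductorNorm ℤ) :=
      Nat.Coprime.coprime_dvd_right conductorNorm_dvd_200E1 (by norm_num)
    rw [Int.gcd, hna, Int.natAbs_natCast]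
    exact h'
  refine printFamily200E1_lower h11 h26 hmod Dt hopt hL F hF (-3 : ℤ) ?_ (by decide) hgcd ?_ ?_ W hW
  · rw [← Int.squarefree_natAbs, hna]; exact hq.prime.squarefree
  · exact ⟨3, by rw [hna, Nat.Prime.primeFactors hq]; simp⟩
  · intro p hp
    rw [hna, Nat.Prime.primeFactors hq, Finset.mem_singleton] at hp
    subst hp
    exact ⟨by norm_num, hin⟩

end Witness200E1

/-! ## Witness member `116B1^{(-3)}`: `a_3(116B1) = 1` odd ⇒ `3` inert in the cubic `2`-division field; `M = 3* = -3 ≡ 1 (mod 4)` -/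
section Witness116B1

/-- **`#Ẽ(𝔽_3) = 3` for `116B1`** (certified count `countPoints`, `decide +kernel`; `3 ∤ Δ = -7424`). [cite: SilvermanAEC2009, V.2] -/
theorem reductionPointCount_3_116B1 [(⟨0, 1, 0, -4, 4⟩ : WeierstrassCurve ℚ).IsGloballyMinimal] :
    (⟨0, 1, 0, -4, 4⟩ : WeierstrassCurve ℚ).reductionPointCount 3 = 3 := by
  haveI : Fact (Nat.Prime 3) := ⟨by norm_num⟩
  haveI := isElliptic_116B1
  exact Supersingular.reductionPointCount_eq_of_intModel_countPoints intModel_116B1 3 (by norm_num) (by decide +kernel)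
    (by decide +kernel)

/-- **`a_3(116B1) = 1` is odd**: `Frob_3` is a `3`-cycle on `E[2] ∖ {0}`, i.e. `3` is inert in the cubic `2`-division field of
`116B1` (Zhai's twisting condition). [cite: Zhai2016, Thm. 1.1 (hypothesis "inert in F")] -/
theorem odd_frobeniusTrace_3_116B1 [(⟨0, 1, 0, -4, 4⟩ : WeierstrassCurve ℚ).IsGloballyMinimal] :
    Odd ((⟨0, 1, 0, -4, 4⟩ : WeierstrassCurve ℚ).frobeniusTrace 3) := by
  rw [Uniform.U2.odd_frobeniusTrace_iff_odd_reductionPointCount _ (by norm_num : Nat.Prime 3) (by norm_num),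
    reductionPointCount_3_116B1]
  decide

/-- **C3″'s conclusion at every global minimal model of `116B1^{(-3)}`** — the member `M = 3* = -3` of the Zhai-1.1 family of
`116B1` (`-3 ≡ 1 (mod 4)` square-free, `(3, N) = 1` since `N ∣ |Δ| = 7424`, `3` inert in the cubic `2`-division field because
`a_3 = 1` is odd — ALL IN THE KERNEL; `F` exists by `U2.exists_isTwoDivisionField`). Displayed: the optimality datum and the record
`ord₂(L(116B1,1)/Ω_∞) = 0`; by name: Zhai Thm. 1.1 (corrected), ARS Thm. 2.6, modularity. The `116B1` road is not vacuous.
BSD is not proved by any of this. [cite: Zhai2016, Thm. 1.1] [cite: AgasheRibetStein2006, Thm. 2.6] [cite: Miller2011LMS, Def. 1.1] -/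
theorem printFamily116B1_witness_neg3 (h11 : thm11_ordTwo_LAlg_twist_eq_zero')
    (h26 : cremona_abs_maninConstant_eq_one_of_level_le) (hmod : hasEntireLFunction_rat)
    [hN : haveI := isElliptic_116B1; NeZero ((⟨0, 1, 0, -4, 4⟩ : WeierstrassCurve ℚ).conductorNorm ℤ)]
    (Dt : haveI := isElliptic_116B1; ModularParametrizationData (⟨0, 1, 0, -4, 4⟩ : WeierstrassCurve ℚ) ((⟨0, 1, 0, -4, 4⟩ : WeierstrassCurve ℚ).conductorNorm ℤ))
    (hopt : haveI := isElliptic_116B1; Zhai2021.IsOptimalDatum (⟨0, 1, 0, -4, 4⟩ : WeierstrassCurve ℚ) Dt)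
    (hL : haveI := isElliptic_116B1; ∃ x : ℚ, IsLAlg (⟨0, 1, 0, -4, 4⟩ : WeierstrassCurve ℚ) x ∧ x ≠ 0 ∧ padicValRat 2 x = 0)
    (W : WeierstrassCurve ℚ) [W.IsElliptic] [W.IsGloballyMinimal]
    (hW : ∃ C : VariableChange ℚ, C • (⟨0, 1, 0, -4, 4⟩ : WeierstrassCurve ℚ).quadraticTwist ((-3 : ℤ) : ℚ) = W) :
    haveI : Fact (Nat.Prime 2) := ⟨Nat.prime_two⟩
    W.analyticRank = 0 ∧ Addv W 2 ∧ 0 ≤ padicValRat 2 W.j ∧ ¬ W.HasCM ∧ Irr W 2 ∧ MissingLowerBoundAt W 2 := by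
  haveI : Fact (Nat.Prime 2) := ⟨Nat.prime_two⟩
  haveI := isElliptic_116B1; haveI := isGloballyMinimal_116B1
  have hq : Nat.Prime 3 := by norm_num
  obtain ⟨F, _, _, hF⟩ := Uniform.U2.exists_isTwoDivisionField (⟨0, 1, 0, -4, 4⟩ : WeierstrassCurve ℚ)
    ((X5.O1.irr_two_iff_forall_two_nsmul _).mp irr_two_116B1)
  have hgood : ¬ ((3 : ℕ) : ℤ) ∣ minimalDiscriminantInt (⟨0, 1, 0, -4, 4⟩ : WeierstrassCurve ℚ) := by
    rw [minimalDiscriminantInt_eq intModel_116B1, M116B1_Δ]; decide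
  have hin : IsInertIn F 3 :=
    Uniform.U2.isInertIn_of_odd_frobeniusTrace _ hF hq (by norm_num) hgood odd_frobeniusTrace_3_116B1
  have hna : (-3 : ℤ).natAbs = 3 := rfl
  have hgcd : Int.gcd (-3 : ℤ) ((⟨0, 1, 0, -4, 4⟩ : WeierstrassCurve ℚ).conductorNorm ℤ) = 1 := by
    have h' : Nat.Coprime 3 ((⟨0, 1, 0, -4, 4⟩ : WeierstrassCurve ℚ).conductorNorm ℤ) :=
      Nat.Coprime.coprime_dvd_right conductorNorm_dvd_116B1 (by norm_num)
    rw [Int.gcd, hna, Int.natAbs_natCast]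
    exact h'
  refine printFamily116B1_lower h11 h26 hmod Dt hopt hL F hF (-3 : ℤ) ?_ (by decide) hgcd ?_ ?_ W hW
  · rw [← Int.squarefree_natAbs, hna]; exact hq.prime.squarefree
  · exact ⟨3, by rw [hna, Nat.Prime.primeFactors hq]; simp⟩
  · intro p hp
    rw [hna, Nat.Prime.primeFactors hq, Finset.mem_singleton] at hp
    subst hp
    exact ⟨by norm_num, hin⟩

end Witness116B1

/-! ## Witness member `540A1^{(17)}`: `a_17(540A1) = 3` odd ⇒ `17` inert in the cubic `2`-division field; `M = 17* = 17 ≡ 1 (mod 4)` -/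
section Witness540A1

/-- **`#Ẽ(𝔽_17) = 15` for `540A1`** (certified count `countPoints`, `decide +kernel`; `17 ∤ Δ = -2160`). [cite: SilvermanAEC2009, V.2] -/
theorem reductionPointCount_17_540A1 [(⟨0, 0, 0, -33, 73⟩ : WeierstrassCurve ℚ).IsGloballyMinimal] :
    (⟨0, 0, 0, -33, 73⟩ : WeierstrassCurve ℚ).reductionPointCount 17 = 15 := by
  haveI : Fact (Nat.Prime 17) := ⟨by norm_num⟩
  haveI := isElliptic_540A1
  exact Supersingular.reductionPointCount_eq_of_intModel_countPoints intModel_540A1 17 (by norm_num) (by decide +kernel)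
    (by decide +kernel)

/-- **`a_17(540A1) = 3` is odd**: `Frob_17` is a `3`-cycle on `E[2] ∖ {0}`, i.e. `17` is inert in the cubic `2`-division field of
`540A1` (Zhai's twisting condition). [cite: Zhai2016, Thm. 1.1 (hypothesis "inert in F")] -/
theorem odd_frobeniusTrace_17_540A1 [(⟨0, 0, 0, -33, 73⟩ : WeierstrassCurve ℚ).IsGloballyMinimal] :
    Odd ((⟨0, 0, 0, -33, 73⟩ : WeierstrassCurve ℚ).frobeniusTrace 17) := by
  rw [Uniform.U2.odd_frobeniusTrace_iff_odd_reductionPointCount _ (by norm_num : Nat.Prime 17) (by norm_num),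
    reductionPointCount_17_540A1]
  decide

/-- **C3″'s conclusion at every global minimal model of `540A1^{(17)}`** — the member `M = 17* = 17` of the Zhai-1.1 family of
`540A1` (`17 ≡ 1 (mod 4)` square-free, `(17, N) = 1` since `N ∣ |Δ| = 2160`, `17` inert in the cubic `2`-division field because
`a_17 = 3` is odd — ALL IN THE KERNEL; `F` exists by `U2.exists_isTwoDivisionField`). Displayed: the optimality datum and the record
`ord₂(L(540A1,1)/Ω_∞) = 0`; by name: Zhai Thm. 1.1 (corrected), ARS Thm. 2.6, modularity. The `540A1` road is not vacuous.
BSD is not proved by any of this. [cite: Zhai2016, Thm. 1.1] [cite: AgasheRibetStein2006, Thm. 2.6] [cite: Miller2011LMS, Def. 1.1] -/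
theorem printFamily540A1_witness_17 (h11 : thm11_ordTwo_LAlg_twist_eq_zero')
    (h26 : cremona_abs_maninConstant_eq_one_of_level_le) (hmod : hasEntireLFunction_rat)
    [hN : haveI := isElliptic_540A1; NeZero ((⟨0, 0, 0, -33, 73⟩ : WeierstrassCurve ℚ).conductorNorm ℤ)]
    (Dt : haveI := isElliptic_540A1; ModularParametrizationData (⟨0, 0, 0, -33, 73⟩ : WeierstrassCurve ℚ) ((⟨0, 0, 0, -33, 73⟩ : WeierstrassCurve ℚ).conductorNorm ℤ))
    (hopt : haveI := isElliptic_540A1; Zhai2021.IsOptimalDatum (⟨0, 0, 0, -33, 73⟩ : WeierstrassCurve ℚ) Dt)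
    (hL : haveI := isElliptic_540A1; ∃ x : ℚ, IsLAlg (⟨0, 0, 0, -33, 73⟩ : WeierstrassCurve ℚ) x ∧ x ≠ 0 ∧ padicValRat 2 x = 0)
    (W : WeierstrassCurve ℚ) [W.IsElliptic] [W.IsGloballyMinimal]
    (hW : ∃ C : VariableChange ℚ, C • (⟨0, 0, 0, -33, 73⟩ : WeierstrassCurve ℚ).quadraticTwist ((17 : ℤ) : ℚ) = W) :
    haveI : Fact (Nat.Prime 2) := ⟨Nat.prime_two⟩
    W.analyticRank = 0 ∧ Addv W 2 ∧ 0 ≤ padicValRat 2 W.j ∧ ¬ W.HasCM ∧ Irr W 2 ∧ MissingLowerBoundAt W 2 := by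
  haveI : Fact (Nat.Prime 2) := ⟨Nat.prime_two⟩
  haveI := isElliptic_540A1; haveI := isGloballyMinimal_540A1
  have hq : Nat.Prime 17 := by norm_num
  obtain ⟨F, _, _, hF⟩ := Uniform.U2.exists_isTwoDivisionField (⟨0, 0, 0, -33, 73⟩ : WeierstrassCurve ℚ)
    ((X5.O1.irr_two_iff_forall_two_nsmul _).mp irr_two_540A1)
  have hgood : ¬ ((17 : ℕ) : ℤ) ∣ minimalDiscriminantInt (⟨0, 0, 0, -33, 73⟩ : WeierstrassCurve ℚ) := by
    rw [minimalDiscriminantInt_eq intModel_540A1, M540A1_Δ]; decide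
  have hin : IsInertIn F 17 :=
    Uniform.U2.isInertIn_of_odd_frobeniusTrace _ hF hq (by norm_num) hgood odd_frobeniusTrace_17_540A1
  have hna : (17 : ℤ).natAbs = 17 := rfl
  have hgcd : Int.gcd (17 : ℤ) ((⟨0, 0, 0, -33, 73⟩ : WeierstrassCurve ℚ).conductorNorm ℤ) = 1 := by
    have h' : Nat.Coprime 17 ((⟨0, 0, 0, -33, 73⟩ : WeierstrassCurve ℚ).conductorNorm ℤ) :=
      Nat.Coprime.coprime_dvd_right conductorNorm_dvd_540A1 (by norm_num)
    rw [Int.gcd, hna, Int.natAbs_natCast]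
    exact h'
  refine printFamily540A1_lower h11 h26 hmod Dt hopt hL F hF (17 : ℤ) ?_ (by decide) hgcd ?_ ?_ W hW
  · rw [← Int.squarefree_natAbs, hna]; exact hq.prime.squarefree
  · exact ⟨17, by rw [hna, Nat.Prime.primeFactors hq]; simp⟩
  · intro p hp
    rw [hna, Nat.Prime.primeFactors hq, Finset.mem_singleton] at hp
    subst hp
    exact ⟨by norm_num, hin⟩

end Witness540A1

/-! ## Witness member `196B1^{(5)}`: `a_5(196B1) = 3` odd ⇒ `5` inert in the cubic `2`-division field; `M = 5* = 5 ≡ 1 (mod 4)` -/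
section Witness196B1

/-- **`#Ẽ(𝔽_5) = 3` for `196B1`** (certified count `countPoints`, `decide +kernel`; `5 ∤ Δ = 92236816`). [cite: SilvermanAEC2009, V.2] -/
theorem reductionPointCount_5_196B1 [(⟨0, 1, 0, -114, -127⟩ : WeierstrassCurve ℚ).IsGloballyMinimal] :
    (⟨0, 1, 0, -114, -127⟩ : WeierstrassCurve ℚ).reductionPointCount 5 = 3 := by
  haveI : Fact (Nat.Prime 5) := ⟨by norm_num⟩
  haveI := isElliptic_196B1
  exact Supersingular.reductionPointCount_eq_of_intModel_countPoints intModel_196B1 5 (by norm_num) (by decide +kernel)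
    (by decide +kernel)

/-- **`a_5(196B1) = 3` is odd**: `Frob_5` is a `3`-cycle on `E[2] ∖ {0}`, i.e. `5` is inert in the cubic `2`-division field of
`196B1` (Zhai's twisting condition). [cite: Zhai2016, Thm. 1.2 (hypothesis "inert in F")] -/
theorem odd_frobeniusTrace_5_196B1 [(⟨0, 1, 0, -114, -127⟩ : WeierstrassCurve ℚ).IsGloballyMinimal] :
    Odd ((⟨0, 1, 0, -114, -127⟩ : WeierstrassCurve ℚ).frobeniusTrace 5) := by
  rw [Uniform.U2.odd_frobeniusTrace_iff_odd_reductionPointCount _ (by norm_num : Nat.Prime 5) (by norm_num),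
    reductionPointCount_5_196B1]
  decide

/-- **C3″'s conclusion at every global minimal model of `196B1^{(5)}`** — the member `M = 5* = 5` of the Zhai-1.2 family of
`196B1` (`5 ≡ 1 (mod 4)` square-free, `M > 0`, `(5, N) = 1` since `N ∣ |Δ| = 92236816`, `5` inert in the cubic `2`-division field because
`a_5 = 3` is odd — ALL IN THE KERNEL; `F` exists by `U2.exists_isTwoDivisionField`). Displayed: the optimality datum and the record
`ord₂(L(196B1,1)/Ω_∞) = 1`; by name: Zhai Thm. 1.2 (corrected), ARS Thm. 2.6, modularity. The `196B1` road is not vacuous.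
BSD is not proved by any of this. [cite: Zhai2016, Thm. 1.2] [cite: AgasheRibetStein2006, Thm. 2.6] [cite: Miller2011LMS, Def. 1.1] -/
theorem printFamily196B1_witness_5 (h12 : thm12_ordTwo_LAlg_twist_eq_one')
    (h26 : cremona_abs_maninConstant_eq_one_of_level_le) (hmod : hasEntireLFunction_rat)
    [hN : haveI := isElliptic_196B1; NeZero ((⟨0, 1, 0, -114, -127⟩ : WeierstrassCurve ℚ).conductorNorm ℤ)]
    (Dt : haveI := isElliptic_196B1; ModularParametrizationData (⟨0, 1, 0, -114, -127⟩ : WeierstrassCurve ℚ) ((⟨0, 1, 0, -114, -127⟩ : WeierstrassCurve ℚ).conductorNorm ℤ))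
    (hopt : haveI := isElliptic_196B1; Zhai2021.IsOptimalDatum (⟨0, 1, 0, -114, -127⟩ : WeierstrassCurve ℚ) Dt)
    (hL : haveI := isElliptic_196B1; ∃ x : ℚ, IsLAlg (⟨0, 1, 0, -114, -127⟩ : WeierstrassCurve ℚ) x ∧ x ≠ 0 ∧ padicValRat 2 x = 1)
    (W : WeierstrassCurve ℚ) [W.IsElliptic] [W.IsGloballyMinimal]
    (hW : ∃ C : VariableChange ℚ, C • (⟨0, 1, 0, -114, -127⟩ : WeierstrassCurve ℚ).quadraticTwist ((5 : ℤ) : ℚ) = W) :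
    haveI : Fact (Nat.Prime 2) := ⟨Nat.prime_two⟩
    W.analyticRank = 0 ∧ Addv W 2 ∧ 0 ≤ padicValRat 2 W.j ∧ ¬ W.HasCM ∧ Irr W 2 ∧ MissingLowerBoundAt W 2 := by
  haveI : Fact (Nat.Prime 2) := ⟨Nat.prime_two⟩
  haveI := isElliptic_196B1; haveI := isGloballyMinimal_196B1
  have hq : Nat.Prime 5 := by norm_num
  obtain ⟨F, _, _, hF⟩ := Uniform.U2.exists_isTwoDivisionField (⟨0, 1, 0, -114, -127⟩ : WeierstrassCurve ℚ)
    ((X5.O1.irr_two_iff_forall_two_nsmul _).mp irr_two_196B1)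
  have hgood : ¬ ((5 : ℕ) : ℤ) ∣ minimalDiscriminantInt (⟨0, 1, 0, -114, -127⟩ : WeierstrassCurve ℚ) := by
    rw [minimalDiscriminantInt_eq intModel_196B1, M196B1_Δ]; decide
  have hin : IsInertIn F 5 :=
    Uniform.U2.isInertIn_of_odd_frobeniusTrace _ hF hq (by norm_num) hgood odd_frobeniusTrace_5_196B1
  have hna : (5 : ℤ).natAbs = 5 := rfl
  have hgcd : Int.gcd (5 : ℤ) ((⟨0, 1, 0, -114, -127⟩ : WeierstrassCurve ℚ).conductorNorm ℤ) = 1 := by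
    have h' : Nat.Coprime 5 ((⟨0, 1, 0, -114, -127⟩ : WeierstrassCurve ℚ).conductorNorm ℤ) :=
      Nat.Coprime.coprime_dvd_right conductorNorm_dvd_196B1 (by norm_num)
    rw [Int.gcd, hna, Int.natAbs_natCast]
    exact h'
  refine printFamily196B1_lower h12 h26 hmod Dt hopt hL F hF (5 : ℤ) (by norm_num) ?_ (by decide) hgcd ?_ ?_ W hW
  · rw [← Int.squarefree_natAbs, hna]; exact hq.prime.squarefree
  · exact ⟨5, by rw [hna, Nat.Prime.primeFactors hq]; simp⟩
  · intro p hp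
    rw [hna, Nat.Prime.primeFactors hq, Finset.mem_singleton] at hp
    subst hp
    exact ⟨by norm_num, hin⟩

end Witness196B1

end Summit.BirchSwinnertonDyer.BirchSwinnertonDyer.Theorems.AddPotGoodPrint

end
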